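import Summits.QuantumFields.YangMills.Theorems.BalabanUVNodesN20CoreEdgeAtShellSplitOfRecord

/-!
# BalabanUVNodes ∕ N20 (NE7b) — the `hedge`-JOINT COMPANION, module 9: N19's core edge of the spine reading of record AT THE SHELL SPLIT OF RECORD FOR EVERY POLICY
# `jcut` (the ZERO cut included) — «the term core of `s` against the term cores of its whole block-down fibre, SUMMED»; lowered-threshold form; the transfers ON THE
# LIVE-SELECTOR LINE with no policy letter

Cell `pub-ymgap` (HUMAN RULING D-0062 Track A; D-0149 width push), seat `pub-ymgap-dag-n20-w3` (WIDTH SEAT 3 of 3 on NODE n20 = NE7b) gen 2, INTENT-8 (pub-ymgap INBOX).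
Modules 7∕8 (`Thm/BalabanUVNodesN20CoreEdgeAtShellSplitOfRecord(Transfer)`) read the core edge at dag-n21-d's shell split of record on N20's GOOD class under a policy with
`1 ≤ jcut K ≤ K₀ + K`, where run B's block-down fibre over a good run-A index is ONE lifted term.  K3⁷ v3 (plan g81, 02f6f498332fdbee) reads the cut PER TUPLE (`CutReading`)
and n20-w2 located the cheapest setting `jcut = 0` (N20's face FREE, p590852; the persistence class EMPTY, `badClass₁₃_cutZero`) — NOT covered by modules 7∕8.  This module
drops the policy letters: module 1's GENERIC termwise iff (`core_twoRunKeyed_iff_termwise`, any `Bad`) at the record's objects, with both keyed shell parts read as TERM shell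
parts — run A's at its own key (module 7 `shellA₁₃_keyA`), run B's as the SUM over node U5d's `truncSeq`-fibre (§1 here).  Filed `--kind proof --supports
stmt-QuantumFields-20544 --as helper` (K3⁷ `SpineGivenEndpointR13SepCoPH`); COUNT-NEUTRAL.  [III] = [Balaban1988Convergent], [LF-I∕II] = [Balaban1989LargeFieldI∕II].

WHAT IS PROVED (bookkeeping; fibre identities, one `Finset.sum_sub_distrib`, rewrites along landed lemmas, dag-n20-d's transfers BY NAME).
* §1 `shellB₁₃_keyA_eq_sum_truncSeq` ∕ `weightB₁₃_keyA_eq_sum_truncSeq`: under `RAgree` and `0 < θ.τ9.M`, at the key of ANY run-A index `s` run B's keyed shell part ∕ class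
  weight of record is the sum of the term shell parts ∕ class weights over `{s' : truncSeq s' = s}` (n19-d B :169 `sum_filter_sigma_twoRunKeyB_keyA_eq_sum_filter_truncSeq`
  + `keyB₁₃_eq`).  (Module 3 `bijOn_levelOne_truncSeq_fibre` says what that fibre IS: run B's admissible level-1 data above `blockUp (s.Ω_1)`; on `Ω_1(s) = T_η` it is
  `{liftSeq s}` — module 7.)
* §2 ★★ `core_shellSplit₁₃_iff_fibreCore` (EVERY policy `jcut`, `(l₀, vol)`-generic, widths `ρA ρB : ℕ → ℝ`): the core edge at the split of record IFF for every `K` ONE `c`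
  with, for all `|t| ≤ l₀` and every run-A index `s` whose key is off the persistence class, `e^{c − vol·δ K}·(cw_A(s) − σ_A(s)) ≤ Σ_{s' : truncSeq s' = s}(cw_B(s') − σ_B(s'))
  ≤ e^{c + vol·δ K}·(cw_A(s) − σ_A(s))` — loss-free.  ★★ `core_cutZero_shellSplit₁₃_iff_fibreCore`: at `jcut := fun _ ↦ 0` the premise is vacuous — the EXACT NE7 core on
  EVERY history, fibre summed: what K3⁷'s stub 2 asks of N19′ at the dial where N20 is free.
* §3 ★★ `core_shellSplit₁₃_iff_loweredFibre`: under (H-U), `0 ≤ ε·ρ` per run and F3's (e1) integrability of both runs' top pieces, the same with every term core READ AS the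
  (2.18) term re-tested at the LOWERED threshold (dag-n21-d §3b `classWeight_sub_shellWeight_eq_lowered`, term by term inside the fibre sum).
* §4 ★★★ `core_crOfRecord₁₃At_shellSplit_of_loweredFibre_liveSel` ∕ `core_crOfRecord₁₃VAt_shellSplit_of_loweredFibre_liveSel`: ON THE LIVE-SELECTOR LINE (`hsel`, (H-U),
  (H-ζ)), for EVERY policy, the core-edge conjunct `NE7.Core … ∧ Summable …` AT `crOfRecord₁₃(V)At K₀ jcut (shellSplitOfRecord₁₃At N K₀ ρA ρB)` from the lowered fibre
  sandwich + `Summable δ` + `hM` + `hR` + the widths' sign — the sign letter `hP0` by module 7, the integrability rows by dag-n21-d's `integrable_topPieceA∕B_of_liveSel`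
  (p593341), `0 ≤ ζ` by n20-w2's `zeta_nonneg_of_provisos₁₃CoPH` (p593923).  Module 8's `…_liveSel` theorems are the `1 ≤ jcut K ≤ K₀ + K` case with the fibre collapsed.

(α) READING ∕ LOCATED banner as in modules 2∕4∕5∕7 (NC-NE7b-α UNRULED; policy and widths are the prover's dials, plan g81 rulings (a); at a junk `θ.ppSel` pin the persistence
class is «ever created», evidence #10).  The flow hypothesis `hR : RAgree` (node U5d, option (c)) stays DISPLAYED: off it run B's classes are indexed by its own coarse history
(n20-w2's flow-free `truncShift ∕ liftShift` files) and one-sided classes are pure shell (n19-d `…N19TargetKeyedUnpartnered`) — not touched here.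

HONEST FRAMING.  Count-neutral bookkeeping; nothing re-typed.  NO estimate is proved: the fibre sandwich IS N19's NE7 core at the record — NOT PRINTED for `d = 4` ([LF-II] p.356),
NOT proved, NAMED OPEN; §2∕§3 are `iff`s (LOCATED), §4 has the sandwich as HYPOTHESIS (inhabited by no Bałaban family today — A2 declared; non-vacuous as statements — A6).  NE7 ∕
NE7b ∕ NE7c NOT PRINTED ∕ NOT PROVED; (α)-instance 0∕1; N19 ∕ N20 ∕ N21 NOT discharged; K3⁷ NOT closed; counts unmoved (typed 28∕28 · discharged 5∕27); no count claim.  One finite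
`𝕋⁴_{L^K}` programme at fixed `ε = L^{−K}` along two consecutive cutoffs, Bałaban AS PRINTED; the YM mass gap (Clay) is NOT proved by any of this — R4 closes the conditional finite-𝕋⁴
rung `BalabanLadder.UV` only; NOT ℝ⁴, NOT OS.  No `instance`, no `notation`, no `def`, no `sorry`, no private decls.  Sources (bookkeeping): [III] (2.1) p.254, (2.5) p.255,
(2.17)–(2.18) p.257; [LF-I] (0.2)–(0.4) p.176, p.193; [LF-II] Thm 1 + (0.1) pp.355–356, (1.80) p.384; [King1986] (3.10) p.656.
-/

noncomputable section

namespace Summit.QuantumFields.YangMills.BalabanUVNodes.N20CoreEdgeAtShellSplitFibre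

open Literature.MathematicalPhysics.QuantumFieldTheory.Balaban1983to89 Literature.MathematicalPhysics.QuantumFieldTheory.Balaban1983to89.T4Continuum
open Literature.MathematicalPhysics.QuantumFieldTheory.Balaban1983to89.Node00
open scoped BigOperators
open MeasureTheory
open B14.Eq218Concrete Summit.QuantumFields.BalabanUV.T4Continuum.Spine
open YMDAG.UVSplit (crOfRecord₁₃At crOfRecord₁₃VAt crOfRecord₁₃ ShellSplit₁₃CoPH keyA₁₃ keyB₁₃ keyB₁₃_eq runA₁₃ runB₁₃ histA₁₃ histB₁₃ classSet₁₃
  weightA₁₃ weightB₁₃ badClass₁₃ core_crOfRecord₁₃At core_crOfRecord₁₃VAt)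
open Summit.QuantumFields.YangMills.Theorems.N21ShellSplitOfRecord13CoPH
open Summit.QuantumFields.YangMills.BalabanUVNodes.N20CoreEdgeAtShellSplit
open Summit.QuantumFields.YangMills.BalabanUVNodes.N20CoreEdgeAtReading13 (core_decidableEq_irrel classSet₁₃_eq weightA₁₃_eq weightB₁₃_eq)
open Summit.QuantumFields.YangMills.BalabanUVNodes.N20CoreEdgeTwoRunKeyed (core_twoRunKeyed_iff_termwise)
open Summit.QuantumFields.YangMills.BalabanUVNodes.N19TargetClassWeightsTwoRunKeyed (sum_filter_sigma_twoRunKeyB_keyA_eq_sum_filter_truncSeq)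
open Summit.QuantumFields.YangMills.BalabanUVNodes.N20KeyedRelWeightCutZero (badClass₁₃_cutZero)
open Summit.QuantumFields.YangMills.BalabanUVNodes.N21KeyedShellWeightShellZero (zeta_nonneg_of_provisos₁₃CoPH)

variable {F : T4Family} {N : ℕ} [NeZero N]
variable (θ : Stage13HParams F N) (hP : θ.Provisos₁₃CoPH F N) (K₀ : ℕ) (g₀ : ℕ → ℝ) (os : List (ULoop F)) (hM : 0 < θ.τ9.M)

/-! ## §1 Run B's keyed objects of record at a run-A key are sums over node U5d's block-down fibre -/

open Classical in
/-- **RUN B's KEYED SHELL PART OF RECORD AT THE KEY OF `s` IS THE SUM OF THE TERM SHELL PARTS OVER THE `truncSeq`-FIBRE OF `s`** (under `RAgree`, `0 < θ.τ9.M`;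
no small-field hypothesis on `s` — n19-d B :169's `sum_filter_sigma_twoRunKeyB_keyA_eq_sum_filter_truncSeq`). [cite: Balaban1988Convergent, (2.5) p.255, (2.18) p.257; King1986, (3.10) p.656 (bookkeeping)] -/
theorem shellB₁₃_keyA_eq_sum_truncSeq {K : ℕ} (hR : RAgree F θ.ν (histA₁₃ θ K₀ g₀ K) (histB₁₃ θ K₀ g₀ K) (K₀ + K)) (ρ : ℕ → ℝ) (t : ℝ)
    (s : SeqOfRecord F θ.ν θ.τ9.M (histA₁₃ θ K₀ g₀ K) (K₀ + K) (K₀ + K)) :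
    shellB₁₃ θ hP K₀ g₀ os ρ K t ⟨K, twoRunKeyA F θ.ν θ.τ9.M (histA₁₃ θ K₀ g₀ K) (K₀ + K) (K₀ + K) s⟩ =
      ∑ s' ∈ Finset.univ.filter (fun s' : SeqOfRecord F θ.ν θ.τ9.M (histB₁₃ θ K₀ g₀ K) (K₀ + K + 1) (K₀ + K + 1) => truncSeq F θ.ν hM hR s' = s),
        shellWeightOfDatum₉ F N θ.toStage9Params (datumOfRecord₁₃CoPH F N θ hP) g₀ os (runB₁₃ F K₀ g₀ K) (histB₁₃ θ K₀ g₀ K) (K₀ + K + 1) (ρ K) t s' := by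
  letI : ∀ Kc, DecidableEq (SiteSeqKey F Kc) := fun _ => Classical.decEq _
  letI : DecidableEq (Σ K, SiteSeqKey F (K₀ + K)) := Classical.decEq _
  unfold shellB₁₃
  have h := sum_filter_sigma_twoRunKeyB_keyA_eq_sum_filter_truncSeq F θ.ν K₀ hM (gA := fun K => histA₁₃ θ K₀ g₀ K) (gB := fun K => histB₁₃ θ K₀ g₀ K) hR
    (fun s' : SeqOfRecord F θ.ν θ.τ9.M (histB₁₃ θ K₀ g₀ K) (K₀ + K + 1) (K₀ + K + 1) =>
      shellWeightOfDatum₉ F N θ.toStage9Params (datumOfRecord₁₃CoPH F N θ hP) g₀ os (runB₁₃ F K₀ g₀ K) (histB₁₃ θ K₀ g₀ K) (K₀ + K + 1) (ρ K) t s') s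
  refine Eq.trans ?_ (h.trans ?_)
  · refine Finset.sum_congr ?_ fun _ _ => rfl
    ext s'
    simp only [Finset.mem_filter, Finset.mem_univ, true_and, keyB₁₃_eq θ K₀ g₀ hM K s']
  · exact Finset.sum_congr (Finset.filter_congr_decidable _ _ _) fun _ _ => rfl

open Classical in
/-- **… AND SO IS RUN B's KEYED CLASS WEIGHT OF RECORD** (the block-down fibre's class weights summed). [cite: Balaban1988Convergent, (2.5) p.255, (2.18) p.257; King1986, (3.10) p.656 (bookkeeping)] -/
theorem weightB₁₃_keyA_eq_sum_truncSeq {K : ℕ} (hR : RAgree F θ.ν (histA₁₃ θ K₀ g₀ K) (histB₁₃ θ K₀ g₀ K) (K₀ + K)) (t : ℝ)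
    (s : SeqOfRecord F θ.ν θ.τ9.M (histA₁₃ θ K₀ g₀ K) (K₀ + K) (K₀ + K)) :
    weightB₁₃ θ hP K₀ g₀ os K t ⟨K, twoRunKeyA F θ.ν θ.τ9.M (histA₁₃ θ K₀ g₀ K) (K₀ + K) (K₀ + K) s⟩ =
      ∑ s' ∈ Finset.univ.filter (fun s' : SeqOfRecord F θ.ν θ.τ9.M (histB₁₃ θ K₀ g₀ K) (K₀ + K + 1) (K₀ + K + 1) => truncSeq F θ.ν hM hR s' = s),
        classWeightOfDatum₉ F N θ.toStage9Params (datumOfRecord₁₃CoPH F N θ hP) g₀ os (runB₁₃ F K₀ g₀ K) (histB₁₃ θ K₀ g₀ K) (K₀ + K + 1) t s' := by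
  letI : ∀ Kc, DecidableEq (SiteSeqKey F Kc) := fun _ => Classical.decEq _
  letI : DecidableEq (Σ K, SiteSeqKey F (K₀ + K)) := Classical.decEq _
  unfold weightB₁₃
  have h := sum_filter_sigma_twoRunKeyB_keyA_eq_sum_filter_truncSeq F θ.ν K₀ hM (gA := fun K => histA₁₃ θ K₀ g₀ K) (gB := fun K => histB₁₃ θ K₀ g₀ K) hR
    (fun s' : SeqOfRecord F θ.ν θ.τ9.M (histB₁₃ θ K₀ g₀ K) (K₀ + K + 1) (K₀ + K + 1) =>
      classWeightOfDatum₉ F N θ.toStage9Params (datumOfRecord₁₃CoPH F N θ hP) g₀ os (runB₁₃ F K₀ g₀ K) (histB₁₃ θ K₀ g₀ K) (K₀ + K + 1) t s') s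
  refine Eq.trans ?_ (h.trans ?_)
  · refine Finset.sum_congr ?_ fun _ _ => rfl
    ext s'
    simp only [Finset.mem_filter, Finset.mem_univ, true_and, keyB₁₃_eq θ K₀ g₀ hM K s']
  · exact Finset.sum_congr (Finset.filter_congr_decidable _ _ _) fun _ _ => rfl

/-! ## §2 At the shell split of record, for ANY policy: N19's core edge IS the term core of `s` against the block-down fibre's term cores SUMMED -/

open Classical in
/-- **★★ AT THE SHELL SPLIT OF RECORD, FOR EVERY POLICY `jcut` (no `1 ≤ jcut K` needed — in particular the ZERO cut), N19's CORE EDGE IS THE FIBRE-CORE SANDWICH —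
LOSS-FREE**: `NE7.Core l₀ vol (classSet₁₃ …) (badClass₁₃ … jcut) (weightA₁₃ − shellA₁₃ ρA) (weightB₁₃ − shellB₁₃ ρB) δ` IFF for every `K` ONE `c` with, for all `|t| ≤ l₀` and
every run-A (2.18) index `s` whose key is NOT in the persistence class, `e^{c − vol·δ K}·(cw_A(s) − σ_A(s)) ≤ Σ_{s' : truncSeq s' = s} (cw_B(s') − σ_B(s')) ≤ e^{c + vol·δ K}·(cw_A(s) − σ_A(s))`
— module 1's generic termwise iff at the record's objects with BOTH keyed shell parts read as TERM shell parts (§1, module 7 §1).  On an index with `Ω_1(s) = T_η` the fibre is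
`{liftSeq s}` and this is module 7's sandwich; in general the fibre is run B's admissible level-1 data above `blockUp (s.Ω_1)` (module 3 `bijOn_levelOne_truncSeq_fibre`).
DISPLAYED: `hM`, the flow hypothesis `hR`, the policy, the widths.  The right-hand side is N19's NE7 core at the record — NOT PRINTED, NOT proved.
[cite: King1986, (3.10) p.656; Balaban1989LargeFieldII, Thm 1 + (0.1) pp.355–356, (1.80) p.384; Balaban1988Convergent, (2.5) p.255, (2.18) p.257; Balaban1989LargeFieldI, p.193 (bookkeeping)] -/
theorem core_shellSplit₁₃_iff_fibreCore (hR : ∀ K, RAgree F θ.ν (histA₁₃ θ K₀ g₀ K) (histB₁₃ θ K₀ g₀ K) (K₀ + K)) (jcut : ℕ → ℕ)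
    (ρA ρB : ℕ → ℝ) (l₀ vol : ℝ) (δ : ℕ → ℝ) :
    (letI : DecidableEq (Σ K, SiteSeqKey F (K₀ + K)) := Classical.decEq _
     NE7.Core l₀ vol (classSet₁₃ θ K₀ g₀) (badClass₁₃ θ K₀ g₀ jcut)
       (fun K t x => weightA₁₃ θ hP K₀ g₀ os K t x - shellA₁₃ θ hP K₀ g₀ os ρA K t x)
       (fun K t x => weightB₁₃ θ hP K₀ g₀ os K t x - shellB₁₃ θ hP K₀ g₀ os ρB K t x) δ)
      ↔ ∀ K : ℕ, ∃ c : ℝ, ∀ t : ℝ, |t| ≤ l₀ → ∀ s : SeqOfRecord F θ.ν θ.τ9.M (histA₁₃ θ K₀ g₀ K) (K₀ + K) (K₀ + K),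
          (⟨K, twoRunKeyA F θ.ν θ.τ9.M (histA₁₃ θ K₀ g₀ K) (K₀ + K) (K₀ + K) s⟩ : Σ K, SiteSeqKey F (K₀ + K)) ∉ badClass₁₃ θ K₀ g₀ jcut K t →
          Real.exp (c - vol * δ K) * (classWeightOfDatum₉ F N θ.toStage9Params (datumOfRecord₁₃CoPH F N θ hP) g₀ os (runA₁₃ F K₀ g₀ K) (histA₁₃ θ K₀ g₀ K) (K₀ + K) t s
              - shellWeightOfDatum₉ F N θ.toStage9Params (datumOfRecord₁₃CoPH F N θ hP) g₀ os (runA₁₃ F K₀ g₀ K) (histA₁₃ θ K₀ g₀ K) (K₀ + K) (ρA K) t s)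
            ≤ ∑ s' ∈ Finset.univ.filter (fun s' : SeqOfRecord F θ.ν θ.τ9.M (histB₁₃ θ K₀ g₀ K) (K₀ + K + 1) (K₀ + K + 1) => truncSeq F θ.ν hM (hR K) s' = s),
                (classWeightOfDatum₉ F N θ.toStage9Params (datumOfRecord₁₃CoPH F N θ hP) g₀ os (runB₁₃ F K₀ g₀ K) (histB₁₃ θ K₀ g₀ K) (K₀ + K + 1) t s'
                  - shellWeightOfDatum₉ F N θ.toStage9Params (datumOfRecord₁₃CoPH F N θ hP) g₀ os (runB₁₃ F K₀ g₀ K) (histB₁₃ θ K₀ g₀ K) (K₀ + K + 1) (ρB K) t s') ∧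
          ∑ s' ∈ Finset.univ.filter (fun s' : SeqOfRecord F θ.ν θ.τ9.M (histB₁₃ θ K₀ g₀ K) (K₀ + K + 1) (K₀ + K + 1) => truncSeq F θ.ν hM (hR K) s' = s),
                (classWeightOfDatum₉ F N θ.toStage9Params (datumOfRecord₁₃CoPH F N θ hP) g₀ os (runB₁₃ F K₀ g₀ K) (histB₁₃ θ K₀ g₀ K) (K₀ + K + 1) t s'
                  - shellWeightOfDatum₉ F N θ.toStage9Params (datumOfRecord₁₃CoPH F N θ hP) g₀ os (runB₁₃ F K₀ g₀ K) (histB₁₃ θ K₀ g₀ K) (K₀ + K + 1) (ρB K) t s')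
            ≤ Real.exp (c + vol * δ K) * (classWeightOfDatum₉ F N θ.toStage9Params (datumOfRecord₁₃CoPH F N θ hP) g₀ os (runA₁₃ F K₀ g₀ K) (histA₁₃ θ K₀ g₀ K) (K₀ + K) t s
              - shellWeightOfDatum₉ F N θ.toStage9Params (datumOfRecord₁₃CoPH F N θ hP) g₀ os (runA₁₃ F K₀ g₀ K) (histA₁₃ θ K₀ g₀ K) (K₀ + K) (ρA K) t s) := by
  letI : ∀ Kc, DecidableEq (SiteSeqKey F Kc) := fun _ => Classical.decEq _
  have key := core_twoRunKeyed_iff_termwise F θ.ν K₀ hM hR (l₀ := l₀) (vol := vol)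
    (fun K t s => classWeightOfDatum₉ F N θ.toStage9Params (datumOfRecord₁₃CoPH F N θ hP) g₀ os (runA₁₃ F K₀ g₀ K) (histA₁₃ θ K₀ g₀ K) (K₀ + K) t s)
    (fun K t s' => classWeightOfDatum₉ F N θ.toStage9Params (datumOfRecord₁₃CoPH F N θ hP) g₀ os (runB₁₃ F K₀ g₀ K) (histB₁₃ θ K₀ g₀ K) (K₀ + K + 1) t s')
    (shellA₁₃ θ hP K₀ g₀ os ρA) (shellB₁₃ θ hP K₀ g₀ os ρB) (badClass₁₃ θ K₀ g₀ jcut) δ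
  have hT : classSet₁₃ θ K₀ g₀ = fun K =>
      Finset.univ.image (fun s : SeqOfRecord F θ.ν θ.τ9.M (histA₁₃ θ K₀ g₀ K) (K₀ + K) (K₀ + K) =>
          (⟨K, twoRunKeyA F θ.ν θ.τ9.M (histA₁₃ θ K₀ g₀ K) (K₀ + K) (K₀ + K) s⟩ : Σ K, SiteSeqKey F (K₀ + K)))
        ∪ Finset.univ.image (fun s' : SeqOfRecord F θ.ν θ.τ9.M (histB₁₃ θ K₀ g₀ K) (K₀ + K + 1) (K₀ + K + 1) =>
          (⟨K, twoRunKeyB F θ.ν hM (histB₁₃ θ K₀ g₀ K) (K₀ + K) (K₀ + K) s'⟩ : Σ K, SiteSeqKey F (K₀ + K))) :=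
    funext fun K => classSet₁₃_eq θ K₀ g₀ hM K
  have hA : (fun K t x => weightA₁₃ θ hP K₀ g₀ os K t x - shellA₁₃ θ hP K₀ g₀ os ρA K t x) = fun K t x =>
      (∑ s ∈ Finset.univ.filter (fun s : SeqOfRecord F θ.ν θ.τ9.M (histA₁₃ θ K₀ g₀ K) (K₀ + K) (K₀ + K) =>
          (⟨K, twoRunKeyA F θ.ν θ.τ9.M (histA₁₃ θ K₀ g₀ K) (K₀ + K) (K₀ + K) s⟩ : Σ K, SiteSeqKey F (K₀ + K)) = x),
        classWeightOfDatum₉ F N θ.toStage9Params (datumOfRecord₁₃CoPH F N θ hP) g₀ os (runA₁₃ F K₀ g₀ K) (histA₁₃ θ K₀ g₀ K) (K₀ + K) t s) - shellA₁₃ θ hP K₀ g₀ os ρA K t x := by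
    funext K t x; rw [weightA₁₃_eq]
  have hB : (fun K t x => weightB₁₃ θ hP K₀ g₀ os K t x - shellB₁₃ θ hP K₀ g₀ os ρB K t x) = fun K t x =>
      (∑ s' ∈ Finset.univ.filter (fun s' : SeqOfRecord F θ.ν θ.τ9.M (histB₁₃ θ K₀ g₀ K) (K₀ + K + 1) (K₀ + K + 1) =>
          (⟨K, twoRunKeyB F θ.ν hM (histB₁₃ θ K₀ g₀ K) (K₀ + K) (K₀ + K) s'⟩ : Σ K, SiteSeqKey F (K₀ + K)) = x),
        classWeightOfDatum₉ F N θ.toStage9Params (datumOfRecord₁₃CoPH F N θ hP) g₀ os (runB₁₃ F K₀ g₀ K) (histB₁₃ θ K₀ g₀ K) (K₀ + K + 1) t s') - shellB₁₃ θ hP K₀ g₀ os ρB K t x := by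
    funext K t x; rw [weightB₁₃_eq θ hP K₀ g₀ os hM]
  rw [hA, hB, hT]
  refine (core_decidableEq_irrel _ _).trans (key.trans ?_)
  refine forall_congr' fun K => exists_congr fun c => forall_congr' fun t => forall_congr' fun _ => forall_congr' fun s =>
    forall_congr' fun _ => ?_
  rw [shellA₁₃_keyA θ hP K₀ g₀ os ρA K t s, shellB₁₃_keyA_eq_sum_truncSeq θ hP K₀ g₀ os hM (hR K) ρB t s, ← Finset.sum_sub_distrib]

open Classical in
/-- **★★ AT THE ZERO CUT** (`jcut := fun _ ↦ 0`: the persistence class is EMPTY, n20-w2's `badClass₁₃_cutZero` — the dial setting at which N20's face is FREE, p590852): the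
core edge at the shell split of record is the fibre-core sandwich ON EVERY run-A (2.18) index, no small-field premise — the EXACT NE7 core on every history, run B's block-down
fibre summed. [cite: King1986, (3.10) p.656; Balaban1989LargeFieldII, Thm 1 + (0.1) pp.355–356; Balaban1988Convergent, (2.5) p.255, (2.18) p.257 (bookkeeping)] -/
theorem core_cutZero_shellSplit₁₃_iff_fibreCore (hR : ∀ K, RAgree F θ.ν (histA₁₃ θ K₀ g₀ K) (histB₁₃ θ K₀ g₀ K) (K₀ + K))
    (ρA ρB : ℕ → ℝ) (l₀ vol : ℝ) (δ : ℕ → ℝ) :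
    (letI : DecidableEq (Σ K, SiteSeqKey F (K₀ + K)) := Classical.decEq _
     NE7.Core l₀ vol (classSet₁₃ θ K₀ g₀) (badClass₁₃ θ K₀ g₀ (fun _ => 0))
       (fun K t x => weightA₁₃ θ hP K₀ g₀ os K t x - shellA₁₃ θ hP K₀ g₀ os ρA K t x)
       (fun K t x => weightB₁₃ θ hP K₀ g₀ os K t x - shellB₁₃ θ hP K₀ g₀ os ρB K t x) δ)
      ↔ ∀ K : ℕ, ∃ c : ℝ, ∀ t : ℝ, |t| ≤ l₀ → ∀ s : SeqOfRecord F θ.ν θ.τ9.M (histA₁₃ θ K₀ g₀ K) (K₀ + K) (K₀ + K),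
          Real.exp (c - vol * δ K) * (classWeightOfDatum₉ F N θ.toStage9Params (datumOfRecord₁₃CoPH F N θ hP) g₀ os (runA₁₃ F K₀ g₀ K) (histA₁₃ θ K₀ g₀ K) (K₀ + K) t s
              - shellWeightOfDatum₉ F N θ.toStage9Params (datumOfRecord₁₃CoPH F N θ hP) g₀ os (runA₁₃ F K₀ g₀ K) (histA₁₃ θ K₀ g₀ K) (K₀ + K) (ρA K) t s)
            ≤ ∑ s' ∈ Finset.univ.filter (fun s' : SeqOfRecord F θ.ν θ.τ9.M (histB₁₃ θ K₀ g₀ K) (K₀ + K + 1) (K₀ + K + 1) => truncSeq F θ.ν hM (hR K) s' = s),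
                (classWeightOfDatum₉ F N θ.toStage9Params (datumOfRecord₁₃CoPH F N θ hP) g₀ os (runB₁₃ F K₀ g₀ K) (histB₁₃ θ K₀ g₀ K) (K₀ + K + 1) t s'
                  - shellWeightOfDatum₉ F N θ.toStage9Params (datumOfRecord₁₃CoPH F N θ hP) g₀ os (runB₁₃ F K₀ g₀ K) (histB₁₃ θ K₀ g₀ K) (K₀ + K + 1) (ρB K) t s') ∧
          ∑ s' ∈ Finset.univ.filter (fun s' : SeqOfRecord F θ.ν θ.τ9.M (histB₁₃ θ K₀ g₀ K) (K₀ + K + 1) (K₀ + K + 1) => truncSeq F θ.ν hM (hR K) s' = s),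
                (classWeightOfDatum₉ F N θ.toStage9Params (datumOfRecord₁₃CoPH F N θ hP) g₀ os (runB₁₃ F K₀ g₀ K) (histB₁₃ θ K₀ g₀ K) (K₀ + K + 1) t s'
                  - shellWeightOfDatum₉ F N θ.toStage9Params (datumOfRecord₁₃CoPH F N θ hP) g₀ os (runB₁₃ F K₀ g₀ K) (histB₁₃ θ K₀ g₀ K) (K₀ + K + 1) (ρB K) t s')
            ≤ Real.exp (c + vol * δ K) * (classWeightOfDatum₉ F N θ.toStage9Params (datumOfRecord₁₃CoPH F N θ hP) g₀ os (runA₁₃ F K₀ g₀ K) (histA₁₃ θ K₀ g₀ K) (K₀ + K) t s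
              - shellWeightOfDatum₉ F N θ.toStage9Params (datumOfRecord₁₃CoPH F N θ hP) g₀ os (runA₁₃ F K₀ g₀ K) (histA₁₃ θ K₀ g₀ K) (K₀ + K) (ρA K) t s) := by
  rw [core_shellSplit₁₃_iff_fibreCore θ hP K₀ g₀ os hM hR (fun _ => 0) ρA ρB l₀ vol δ]
  refine forall_congr' fun K => exists_congr fun c => forall_congr' fun t => forall_congr' fun _ => forall_congr' fun s => ?_
  simp only [badClass₁₃_cutZero, Finset.notMem_empty, not_false_eq_true, forall_const]

/-! ## §3 The same with every term core READ AT THE LOWERED THRESHOLD (dag-n21-d's §3b), and the transfer at the zero-cut reading -/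

open Classical in
/-- **★★ THE FIBRE-CORE SANDWICH WITH LOWERED-THRESHOLD TERMS, EVERY POLICY**: under (H-U), `0 ≤ ε·ρ` per run and F3's (e1) integrability of both runs' top pieces, the core
edge at the shell split of record IFF for every `K` ONE `c` with, for all `|t| ≤ l₀` and every run-A index `s` off the persistence class,
`e^{c − vol·δ K}·∫ χ^{ε(1−ρA)}(s)·slot_A(s) ≤ Σ_{s' : truncSeq s' = s} ∫ χ^{ε(1−ρB)}(s')·slot_B(s') ≤ e^{c + vol·δ K}·∫ χ^{ε(1−ρA)}(s)·slot_A(s)` — the (2.18) term of `s`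
re-tested at the lowered threshold against the lowered-threshold terms of its whole block-down fibre.  NOT PRINTED, NOT proved (displayed as the right-hand side).
[cite: King1986, (3.10) p.656; Balaban1989LargeFieldII, Thm 1 + (0.1) pp.355–356, (1.80) p.384; Balaban1988Convergent, (2.5) p.255, (2.17)–(2.18) p.257; Balaban1989LargeFieldI, p.193 (bookkeeping)] -/
theorem core_shellSplit₁₃_iff_loweredFibre (hR : ∀ K, RAgree F θ.ν (histA₁₃ θ K₀ g₀ K) (histB₁₃ θ K₀ g₀ K) (K₀ + K)) (jcut : ℕ → ℕ)
    (ρA ρB : ℕ → ℝ) (l₀ vol : ℝ) (δ : ℕ → ℝ)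
    (hU : LocalBgMeasurable F N θ.ν)
    (hρA : ∀ K, 0 ≤ epsOfRecord θ.ν (histA₁₃ θ K₀ g₀ K) (K₀ + K) * ρA K)
    (hρB : ∀ K, 0 ≤ epsOfRecord θ.ν (histB₁₃ θ K₀ g₀ K) (K₀ + K + 1) * ρB K)
    (hintA : ∀ (K : ℕ) (t : ℝ) (s : SeqOfRecord F θ.ν θ.τ9.M (histA₁₃ θ K₀ g₀ K) (K₀ + K) (K₀ + K)),
      Integrable (fun V => chiSeqOfRecord F N θ.ν θ.τ9.M (histA₁₃ θ K₀ g₀ K) (K₀ + K) (K₀ + K) s V *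
        dressedSlotsOfDatum₉ F N θ.toStage9Params (datumOfRecord₁₃CoPH F N θ hP) g₀ os t (runA₁₃ F K₀ g₀ K) (histA₁₃ θ K₀ g₀ K) (K₀ + K) s V)
        (fieldMeasure (F.P (K₀ + K)) (K₀ + K) (Node00.SU N)))
    (hintB : ∀ (K : ℕ) (t : ℝ) (s' : SeqOfRecord F θ.ν θ.τ9.M (histB₁₃ θ K₀ g₀ K) (K₀ + K + 1) (K₀ + K + 1)),
      Integrable (fun V => chiSeqOfRecord F N θ.ν θ.τ9.M (histB₁₃ θ K₀ g₀ K) (K₀ + K + 1) (K₀ + K + 1) s' V *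
        dressedSlotsOfDatum₉ F N θ.toStage9Params (datumOfRecord₁₃CoPH F N θ hP) g₀ os t (runB₁₃ F K₀ g₀ K) (histB₁₃ θ K₀ g₀ K) (K₀ + K + 1) s' V)
        (fieldMeasure (F.P (K₀ + K + 1)) (K₀ + K + 1) (Node00.SU N))) :
    (letI : DecidableEq (Σ K, SiteSeqKey F (K₀ + K)) := Classical.decEq _
     NE7.Core l₀ vol (classSet₁₃ θ K₀ g₀) (badClass₁₃ θ K₀ g₀ jcut)
       (fun K t x => weightA₁₃ θ hP K₀ g₀ os K t x - shellA₁₃ θ hP K₀ g₀ os ρA K t x)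
       (fun K t x => weightB₁₃ θ hP K₀ g₀ os K t x - shellB₁₃ θ hP K₀ g₀ os ρB K t x) δ)
      ↔ ∀ K : ℕ, ∃ c : ℝ, ∀ t : ℝ, |t| ≤ l₀ → ∀ s : SeqOfRecord F θ.ν θ.τ9.M (histA₁₃ θ K₀ g₀ K) (K₀ + K) (K₀ + K),
          (⟨K, twoRunKeyA F θ.ν θ.τ9.M (histA₁₃ θ K₀ g₀ K) (K₀ + K) (K₀ + K) s⟩ : Σ K, SiteSeqKey F (K₀ + K)) ∉ badClass₁₃ θ K₀ g₀ jcut K t →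
          Real.exp (c - vol * δ K) *
                (∫ V, chiSeqOfRecordAt F N θ.ν θ.τ9.M (histA₁₃ θ K₀ g₀ K) (K₀ + K) (K₀ + K)
                    (epsOfRecord θ.ν (histA₁₃ θ K₀ g₀ K) (K₀ + K) * (1 - ρA K)) s V *
                  dressedSlotsOfDatum₉ F N θ.toStage9Params (datumOfRecord₁₃CoPH F N θ hP) g₀ os t (runA₁₃ F K₀ g₀ K) (histA₁₃ θ K₀ g₀ K) (K₀ + K) s V
                  ∂fieldMeasure (F.P (K₀ + K)) (K₀ + K) (Node00.SU N))
            ≤ ∑ s' ∈ Finset.univ.filter (fun s' : SeqOfRecord F θ.ν θ.τ9.M (histB₁₃ θ K₀ g₀ K) (K₀ + K + 1) (K₀ + K + 1) => truncSeq F θ.ν hM (hR K) s' = s),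
                (∫ V, chiSeqOfRecordAt F N θ.ν θ.τ9.M (histB₁₃ θ K₀ g₀ K) (K₀ + K + 1) (K₀ + K + 1)
                    (epsOfRecord θ.ν (histB₁₃ θ K₀ g₀ K) (K₀ + K + 1) * (1 - ρB K)) s' V *
                  dressedSlotsOfDatum₉ F N θ.toStage9Params (datumOfRecord₁₃CoPH F N θ hP) g₀ os t (runB₁₃ F K₀ g₀ K) (histB₁₃ θ K₀ g₀ K) (K₀ + K + 1) s' V
                  ∂fieldMeasure (F.P (K₀ + K + 1)) (K₀ + K + 1) (Node00.SU N)) ∧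
          ∑ s' ∈ Finset.univ.filter (fun s' : SeqOfRecord F θ.ν θ.τ9.M (histB₁₃ θ K₀ g₀ K) (K₀ + K + 1) (K₀ + K + 1) => truncSeq F θ.ν hM (hR K) s' = s),
                (∫ V, chiSeqOfRecordAt F N θ.ν θ.τ9.M (histB₁₃ θ K₀ g₀ K) (K₀ + K + 1) (K₀ + K + 1)
                    (epsOfRecord θ.ν (histB₁₃ θ K₀ g₀ K) (K₀ + K + 1) * (1 - ρB K)) s' V *
                  dressedSlotsOfDatum₉ F N θ.toStage9Params (datumOfRecord₁₃CoPH F N θ hP) g₀ os t (runB₁₃ F K₀ g₀ K) (histB₁₃ θ K₀ g₀ K) (K₀ + K + 1) s' V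
                  ∂fieldMeasure (F.P (K₀ + K + 1)) (K₀ + K + 1) (Node00.SU N))
            ≤ Real.exp (c + vol * δ K) *
                (∫ V, chiSeqOfRecordAt F N θ.ν θ.τ9.M (histA₁₃ θ K₀ g₀ K) (K₀ + K) (K₀ + K)
                    (epsOfRecord θ.ν (histA₁₃ θ K₀ g₀ K) (K₀ + K) * (1 - ρA K)) s V *
                  dressedSlotsOfDatum₉ F N θ.toStage9Params (datumOfRecord₁₃CoPH F N θ hP) g₀ os t (runA₁₃ F K₀ g₀ K) (histA₁₃ θ K₀ g₀ K) (K₀ + K) s V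
                  ∂fieldMeasure (F.P (K₀ + K)) (K₀ + K) (Node00.SU N)) := by
  rw [core_shellSplit₁₃_iff_fibreCore θ hP K₀ g₀ os hM hR jcut ρA ρB l₀ vol δ]
  refine forall_congr' fun K => exists_congr fun c => forall_congr' fun t => forall_congr' fun _ => forall_congr' fun s =>
    forall_congr' fun _ => ?_
  have hB : ∑ s' ∈ Finset.univ.filter (fun s' : SeqOfRecord F θ.ν θ.τ9.M (histB₁₃ θ K₀ g₀ K) (K₀ + K + 1) (K₀ + K + 1) => truncSeq F θ.ν hM (hR K) s' = s),
        (classWeightOfDatum₉ F N θ.toStage9Params (datumOfRecord₁₃CoPH F N θ hP) g₀ os (runB₁₃ F K₀ g₀ K) (histB₁₃ θ K₀ g₀ K) (K₀ + K + 1) t s'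
          - shellWeightOfDatum₉ F N θ.toStage9Params (datumOfRecord₁₃CoPH F N θ hP) g₀ os (runB₁₃ F K₀ g₀ K) (histB₁₃ θ K₀ g₀ K) (K₀ + K + 1) (ρB K) t s')
      = ∑ s' ∈ Finset.univ.filter (fun s' : SeqOfRecord F θ.ν θ.τ9.M (histB₁₃ θ K₀ g₀ K) (K₀ + K + 1) (K₀ + K + 1) => truncSeq F θ.ν hM (hR K) s' = s),
        (∫ V, chiSeqOfRecordAt F N θ.ν θ.τ9.M (histB₁₃ θ K₀ g₀ K) (K₀ + K + 1) (K₀ + K + 1)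
                    (epsOfRecord θ.ν (histB₁₃ θ K₀ g₀ K) (K₀ + K + 1) * (1 - ρB K)) s' V *
                  dressedSlotsOfDatum₉ F N θ.toStage9Params (datumOfRecord₁₃CoPH F N θ hP) g₀ os t (runB₁₃ F K₀ g₀ K) (histB₁₃ θ K₀ g₀ K) (K₀ + K + 1) s' V
                  ∂fieldMeasure (F.P (K₀ + K + 1)) (K₀ + K + 1) (Node00.SU N)) :=
    Finset.sum_congr rfl fun s' _ =>
      classWeight_sub_shellWeight_eq_lowered F N θ.toStage9Params (datumOfRecord₁₃CoPH F N θ hP) g₀ os (runB₁₃ F K₀ g₀ K) (histB₁₃ θ K₀ g₀ K) (K₀ + K + 1)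
        hU (hρB K) t s' (hintB K t s')
  rw [classWeight_sub_shellWeight_eq_lowered F N θ.toStage9Params (datumOfRecord₁₃CoPH F N θ hP) g₀ os (runA₁₃ F K₀ g₀ K) (histA₁₃ θ K₀ g₀ K) (K₀ + K)
      hU (hρA K) t s (hintA K t s), hB]
  exact Iff.rfl

/-! ## §4 ON THE LIVE-SELECTOR LINE, EVERY POLICY: the core-edge conjunct at `crOfRecord₁₃(V)At K₀ jcut (shellSplitOfRecord₁₃At …)` from the lowered FIBRE sandwich —
no `1 ≤ jcut K` letter (so the ZERO cut is included), F3's (e1) integrability and `0 ≤ ζ` discharged (dag-n21-d FILE 3 §6, n20-w2) -/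

open Classical in
/-- **★★★ ON THE LIVE-SELECTOR LINE, N19′'s CORE EDGE AT `crOfRecord₁₃At K₀ jcut (shellSplitOfRecord₁₃At N K₀ ρA ρB)` FOR EVERY POLICY `jcut` FROM THE LOWERED FIBRE
SANDWICH** — DISPLAYED: the live-selector pin `hsel`, (H-U), (H-ζ), `hM`, the flow hypothesis `hR`, the widths' sign, a summable `δ`, and the sandwich «the (2.18) term of
`s` re-tested at `ε_k(1−ρA)` vs the lowered-threshold terms of its whole block-down fibre, summed» on the run-A indices off the persistence class (N19's NE7 core at the record;
NOT PRINTED, NOT proved).  At `jcut := fun _ ↦ 0` the premise `∉ badClass₁₃` is vacuous (n20-w2's `badClass₁₃_cutZero`).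
[cite: King1986, (3.10) p.656; Balaban1989LargeFieldII, Thm 1 + (0.1) pp.355–356, (1.80) p.384; Balaban1988Convergent, (2.5) p.255, (2.17)–(2.18) p.257; Balaban1989LargeFieldI, (0.3) p.176, p.193 (bookkeeping)] -/
theorem core_crOfRecord₁₃At_shellSplit_of_loweredFibre_liveSel (hR : ∀ K, RAgree F θ.ν (histA₁₃ θ K₀ g₀ K) (histB₁₃ θ K₀ g₀ K) (K₀ + K))
    (jcut : ℕ → ℕ) (ρA ρB : WidthLetter₁₃CoPH N) {δ : ℕ → ℝ} (hδ : Summable δ)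
    (E : B12.RunParams → ℝ) (hsel : θ.ppSel = ppSelLiveOfRecord F N θ.ν θ.τ9 E (wOfRecord₉ F N θ.toStage9Params))
    (hU : LocalBgMeasurable F N θ.ν) (hζm : ZetaMeasurable F N θ.ζ)
    (hρA : ∀ K, 0 ≤ epsOfRecord θ.ν (histA₁₃ θ K₀ g₀ K) (K₀ + K) * ρA F θ hP g₀ os K)
    (hρB : ∀ K, 0 ≤ epsOfRecord θ.ν (histB₁₃ θ K₀ g₀ K) (K₀ + K + 1) * ρB F θ hP g₀ os K)
    (hlow : ∀ K : ℕ, ∃ c : ℝ, ∀ t : ℝ, |t| ≤ 1 → ∀ s : SeqOfRecord F θ.ν θ.τ9.M (histA₁₃ θ K₀ g₀ K) (K₀ + K) (K₀ + K),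
      (⟨K, twoRunKeyA F θ.ν θ.τ9.M (histA₁₃ θ K₀ g₀ K) (K₀ + K) (K₀ + K) s⟩ : Σ K, SiteSeqKey F (K₀ + K)) ∉ badClass₁₃ θ K₀ g₀ jcut K t →
      Real.exp (c - 1 * δ K) *
            (∫ V, chiSeqOfRecordAt F N θ.ν θ.τ9.M (histA₁₃ θ K₀ g₀ K) (K₀ + K) (K₀ + K)
                    (epsOfRecord θ.ν (histA₁₃ θ K₀ g₀ K) (K₀ + K) * (1 - ρA F θ hP g₀ os K)) s V *
                  dressedSlotsOfDatum₉ F N θ.toStage9Params (datumOfRecord₁₃CoPH F N θ hP) g₀ os t (runA₁₃ F K₀ g₀ K) (histA₁₃ θ K₀ g₀ K) (K₀ + K) s V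
                  ∂fieldMeasure (F.P (K₀ + K)) (K₀ + K) (Node00.SU N))
        ≤ ∑ s' ∈ Finset.univ.filter (fun s' : SeqOfRecord F θ.ν θ.τ9.M (histB₁₃ θ K₀ g₀ K) (K₀ + K + 1) (K₀ + K + 1) => truncSeq F θ.ν hM (hR K) s' = s),
            (∫ V, chiSeqOfRecordAt F N θ.ν θ.τ9.M (histB₁₃ θ K₀ g₀ K) (K₀ + K + 1) (K₀ + K + 1)
                    (epsOfRecord θ.ν (histB₁₃ θ K₀ g₀ K) (K₀ + K + 1) * (1 - ρB F θ hP g₀ os K)) s' V *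
                  dressedSlotsOfDatum₉ F N θ.toStage9Params (datumOfRecord₁₃CoPH F N θ hP) g₀ os t (runB₁₃ F K₀ g₀ K) (histB₁₃ θ K₀ g₀ K) (K₀ + K + 1) s' V
                  ∂fieldMeasure (F.P (K₀ + K + 1)) (K₀ + K + 1) (Node00.SU N)) ∧
      ∑ s' ∈ Finset.univ.filter (fun s' : SeqOfRecord F θ.ν θ.τ9.M (histB₁₃ θ K₀ g₀ K) (K₀ + K + 1) (K₀ + K + 1) => truncSeq F θ.ν hM (hR K) s' = s),
            (∫ V, chiSeqOfRecordAt F N θ.ν θ.τ9.M (histB₁₃ θ K₀ g₀ K) (K₀ + K + 1) (K₀ + K + 1)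
                    (epsOfRecord θ.ν (histB₁₃ θ K₀ g₀ K) (K₀ + K + 1) * (1 - ρB F θ hP g₀ os K)) s' V *
                  dressedSlotsOfDatum₉ F N θ.toStage9Params (datumOfRecord₁₃CoPH F N θ hP) g₀ os t (runB₁₃ F K₀ g₀ K) (histB₁₃ θ K₀ g₀ K) (K₀ + K + 1) s' V
                  ∂fieldMeasure (F.P (K₀ + K + 1)) (K₀ + K + 1) (Node00.SU N))
        ≤ Real.exp (c + 1 * δ K) *
            (∫ V, chiSeqOfRecordAt F N θ.ν θ.τ9.M (histA₁₃ θ K₀ g₀ K) (K₀ + K) (K₀ + K)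
                    (epsOfRecord θ.ν (histA₁₃ θ K₀ g₀ K) (K₀ + K) * (1 - ρA F θ hP g₀ os K)) s V *
                  dressedSlotsOfDatum₉ F N θ.toStage9Params (datumOfRecord₁₃CoPH F N θ hP) g₀ os t (runA₁₃ F K₀ g₀ K) (histA₁₃ θ K₀ g₀ K) (K₀ + K) s V
                  ∂fieldMeasure (F.P (K₀ + K)) (K₀ + K) (Node00.SU N))) :
    (letI := (crOfRecord₁₃At K₀ jcut (shellSplitOfRecord₁₃At N K₀ ρA ρB) F θ hP g₀ os).dec
     NE7.Core (crOfRecord₁₃At K₀ jcut (shellSplitOfRecord₁₃At N K₀ ρA ρB) F θ hP g₀ os).l₀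
      (crOfRecord₁₃At K₀ jcut (shellSplitOfRecord₁₃At N K₀ ρA ρB) F θ hP g₀ os).vol (crOfRecord₁₃At K₀ jcut (shellSplitOfRecord₁₃At N K₀ ρA ρB) F θ hP g₀ os).T
      (crOfRecord₁₃At K₀ jcut (shellSplitOfRecord₁₃At N K₀ ρA ρB) F θ hP g₀ os).Bad
      (fun K t τ => (crOfRecord₁₃At K₀ jcut (shellSplitOfRecord₁₃At N K₀ ρA ρB) F θ hP g₀ os).A K t τ
        - (crOfRecord₁₃At K₀ jcut (shellSplitOfRecord₁₃At N K₀ ρA ρB) F θ hP g₀ os).shA K t τ)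
      (fun K t τ => (crOfRecord₁₃At K₀ jcut (shellSplitOfRecord₁₃At N K₀ ρA ρB) F θ hP g₀ os).B K t τ
        - (crOfRecord₁₃At K₀ jcut (shellSplitOfRecord₁₃At N K₀ ρA ρB) F θ hP g₀ os).shB K t τ)
      (crOfRecord₁₃At K₀ jcut (shellSplitOfRecord₁₃At N K₀ ρA ρB) F θ hP g₀ os).δ) ∧
      Summable (crOfRecord₁₃At K₀ jcut (shellSplitOfRecord₁₃At N K₀ ρA ρB) F θ hP g₀ os).δ :=
  core_crOfRecord₁₃At K₀ jcut (shellSplitOfRecord₁₃At N K₀ ρA ρB) θ hP g₀ os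
    (fun K t _ x _ => weightA₁₃_sub_shellA₁₃_nonneg θ hP K₀ g₀ os (ρA F θ hP g₀ os)
      (integrable_topPieceA_of_liveSel K₀ θ hP E hsel hU hζm (zeta_nonneg_of_provisos₁₃CoPH F θ hP) g₀ os) K t x)
    ((core_shellSplit₁₃_iff_loweredFibre θ hP K₀ g₀ os hM hR jcut (ρA F θ hP g₀ os) (ρB F θ hP g₀ os) 1 1 δ hU hρA hρB
      (integrable_topPieceA_of_liveSel K₀ θ hP E hsel hU hζm (zeta_nonneg_of_provisos₁₃CoPH F θ hP) g₀ os)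
      (integrable_topPieceB_of_liveSel K₀ θ hP E hsel hU hζm (zeta_nonneg_of_provisos₁₃CoPH F θ hP) g₀ os)).2 hlow) hδ

open Classical in
/-- **★★★ THE SAME AT THE PHYSICAL-VOLUME READING `crOfRecord₁₃VAt K₀ jcut (shellSplitOfRecord₁₃At N K₀ ρA ρB)`** (exponents `c ∓ F.side^4·δ K`) — the edition K3⁷ v3's
`PinnedAtLive` names per tuple (`crOfRecord₁₃V_eq`). [cite: King1986, (3.10) p.656; Balaban1989LargeFieldII, Thm 1 + (0.1) pp.355–356, (1.80) p.384; Balaban1988Convergent, (2.5) p.255, (2.17)–(2.18) p.257 (bookkeeping)] -/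
theorem core_crOfRecord₁₃VAt_shellSplit_of_loweredFibre_liveSel (hR : ∀ K, RAgree F θ.ν (histA₁₃ θ K₀ g₀ K) (histB₁₃ θ K₀ g₀ K) (K₀ + K))
    (jcut : ℕ → ℕ) (ρA ρB : WidthLetter₁₃CoPH N) {δ : ℕ → ℝ} (hδ : Summable δ)
    (E : B12.RunParams → ℝ) (hsel : θ.ppSel = ppSelLiveOfRecord F N θ.ν θ.τ9 E (wOfRecord₉ F N θ.toStage9Params))
    (hU : LocalBgMeasurable F N θ.ν) (hζm : ZetaMeasurable F N θ.ζ)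
    (hρA : ∀ K, 0 ≤ epsOfRecord θ.ν (histA₁₃ θ K₀ g₀ K) (K₀ + K) * ρA F θ hP g₀ os K)
    (hρB : ∀ K, 0 ≤ epsOfRecord θ.ν (histB₁₃ θ K₀ g₀ K) (K₀ + K + 1) * ρB F θ hP g₀ os K)
    (hlow : ∀ K : ℕ, ∃ c : ℝ, ∀ t : ℝ, |t| ≤ 1 → ∀ s : SeqOfRecord F θ.ν θ.τ9.M (histA₁₃ θ K₀ g₀ K) (K₀ + K) (K₀ + K),
      (⟨K, twoRunKeyA F θ.ν θ.τ9.M (histA₁₃ θ K₀ g₀ K) (K₀ + K) (K₀ + K) s⟩ : Σ K, SiteSeqKey F (K₀ + K)) ∉ badClass₁₃ θ K₀ g₀ jcut K t →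
      Real.exp (c - F.side ^ 4 * δ K) *
            (∫ V, chiSeqOfRecordAt F N θ.ν θ.τ9.M (histA₁₃ θ K₀ g₀ K) (K₀ + K) (K₀ + K)
                    (epsOfRecord θ.ν (histA₁₃ θ K₀ g₀ K) (K₀ + K) * (1 - ρA F θ hP g₀ os K)) s V *
                  dressedSlotsOfDatum₉ F N θ.toStage9Params (datumOfRecord₁₃CoPH F N θ hP) g₀ os t (runA₁₃ F K₀ g₀ K) (histA₁₃ θ K₀ g₀ K) (K₀ + K) s V
                  ∂fieldMeasure (F.P (K₀ + K)) (K₀ + K) (Node00.SU N))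
        ≤ ∑ s' ∈ Finset.univ.filter (fun s' : SeqOfRecord F θ.ν θ.τ9.M (histB₁₃ θ K₀ g₀ K) (K₀ + K + 1) (K₀ + K + 1) => truncSeq F θ.ν hM (hR K) s' = s),
            (∫ V, chiSeqOfRecordAt F N θ.ν θ.τ9.M (histB₁₃ θ K₀ g₀ K) (K₀ + K + 1) (K₀ + K + 1)
                    (epsOfRecord θ.ν (histB₁₃ θ K₀ g₀ K) (K₀ + K + 1) * (1 - ρB F θ hP g₀ os K)) s' V *
                  dressedSlotsOfDatum₉ F N θ.toStage9Params (datumOfRecord₁₃CoPH F N θ hP) g₀ os t (runB₁₃ F K₀ g₀ K) (histB₁₃ θ K₀ g₀ K) (K₀ + K + 1) s' V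
                  ∂fieldMeasure (F.P (K₀ + K + 1)) (K₀ + K + 1) (Node00.SU N)) ∧
      ∑ s' ∈ Finset.univ.filter (fun s' : SeqOfRecord F θ.ν θ.τ9.M (histB₁₃ θ K₀ g₀ K) (K₀ + K + 1) (K₀ + K + 1) => truncSeq F θ.ν hM (hR K) s' = s),
            (∫ V, chiSeqOfRecordAt F N θ.ν θ.τ9.M (histB₁₃ θ K₀ g₀ K) (K₀ + K + 1) (K₀ + K + 1)
                    (epsOfRecord θ.ν (histB₁₃ θ K₀ g₀ K) (K₀ + K + 1) * (1 - ρB F θ hP g₀ os K)) s' V *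
                  dressedSlotsOfDatum₉ F N θ.toStage9Params (datumOfRecord₁₃CoPH F N θ hP) g₀ os t (runB₁₃ F K₀ g₀ K) (histB₁₃ θ K₀ g₀ K) (K₀ + K + 1) s' V
                  ∂fieldMeasure (F.P (K₀ + K + 1)) (K₀ + K + 1) (Node00.SU N))
        ≤ Real.exp (c + F.side ^ 4 * δ K) *
            (∫ V, chiSeqOfRecordAt F N θ.ν θ.τ9.M (histA₁₃ θ K₀ g₀ K) (K₀ + K) (K₀ + K)
                    (epsOfRecord θ.ν (histA₁₃ θ K₀ g₀ K) (K₀ + K) * (1 - ρA F θ hP g₀ os K)) s V *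
                  dressedSlotsOfDatum₉ F N θ.toStage9Params (datumOfRecord₁₃CoPH F N θ hP) g₀ os t (runA₁₃ F K₀ g₀ K) (histA₁₃ θ K₀ g₀ K) (K₀ + K) s V
                  ∂fieldMeasure (F.P (K₀ + K)) (K₀ + K) (Node00.SU N))) :
    (letI := (crOfRecord₁₃VAt K₀ jcut (shellSplitOfRecord₁₃At N K₀ ρA ρB) F θ hP g₀ os).dec
     NE7.Core (crOfRecord₁₃VAt K₀ jcut (shellSplitOfRecord₁₃At N K₀ ρA ρB) F θ hP g₀ os).l₀
      (crOfRecord₁₃VAt K₀ jcut (shellSplitOfRecord₁₃At N K₀ ρA ρB) F θ hP g₀ os).vol (crOfRecord₁₃VAt K₀ jcut (shellSplitOfRecord₁₃At N K₀ ρA ρB) F θ hP g₀ os).T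
      (crOfRecord₁₃VAt K₀ jcut (shellSplitOfRecord₁₃At N K₀ ρA ρB) F θ hP g₀ os).Bad
      (fun K t τ => (crOfRecord₁₃VAt K₀ jcut (shellSplitOfRecord₁₃At N K₀ ρA ρB) F θ hP g₀ os).A K t τ
        - (crOfRecord₁₃VAt K₀ jcut (shellSplitOfRecord₁₃At N K₀ ρA ρB) F θ hP g₀ os).shA K t τ)
      (fun K t τ => (crOfRecord₁₃VAt K₀ jcut (shellSplitOfRecord₁₃At N K₀ ρA ρB) F θ hP g₀ os).B K t τ
        - (crOfRecord₁₃VAt K₀ jcut (shellSplitOfRecord₁₃At N K₀ ρA ρB) F θ hP g₀ os).shB K t τ)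
      (crOfRecord₁₃VAt K₀ jcut (shellSplitOfRecord₁₃At N K₀ ρA ρB) F θ hP g₀ os).δ) ∧
      Summable (crOfRecord₁₃VAt K₀ jcut (shellSplitOfRecord₁₃At N K₀ ρA ρB) F θ hP g₀ os).δ :=
  core_crOfRecord₁₃VAt K₀ jcut (shellSplitOfRecord₁₃At N K₀ ρA ρB) θ hP g₀ os
    (fun K t _ x _ => weightA₁₃_sub_shellA₁₃_nonneg θ hP K₀ g₀ os (ρA F θ hP g₀ os)
      (integrable_topPieceA_of_liveSel K₀ θ hP E hsel hU hζm (zeta_nonneg_of_provisos₁₃CoPH F θ hP) g₀ os) K t x)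
    ((core_shellSplit₁₃_iff_loweredFibre θ hP K₀ g₀ os hM hR jcut (ρA F θ hP g₀ os) (ρB F θ hP g₀ os) 1 (F.side ^ 4) δ hU hρA hρB
      (integrable_topPieceA_of_liveSel K₀ θ hP E hsel hU hζm (zeta_nonneg_of_provisos₁₃CoPH F θ hP) g₀ os)
      (integrable_topPieceB_of_liveSel K₀ θ hP E hsel hU hζm (zeta_nonneg_of_provisos₁₃CoPH F θ hP) g₀ os)).2 hlow) hδ


end Summit.QuantumFields.YangMills.BalabanUVNodes.N20CoreEdgeAtShellSplitFibre

end
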